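import Summits.HodgeConjecture.CorCM.OcticWeilFourfoldFrameTransfer
import Summits.HodgeConjecture.CorCM.OcticWeilFourfoldWeilParts
import Summits.HodgeConjecture.CorCM.QuadraticCMTypeSlice
import HarnessLib

/-!
# COR-CM — the Hodge conjecture for ALL PRODUCTS OF COPIES `B^n × E^a` of a SIMPLE CM abelian fourfold `B` of WEIL
# TYPE (octic CM field `F ⊇ k`, `k`-signature `(2,2)`) and the CM curve `E` of `k`, GIVEN ONLY Markman's FOURFOLD
# theorem: assembly (frame form, `2`-transitivity as hypothesis)

Cell `pub-hodgecm2` (COR-CM), seat b30 gen 19 (2026-08-21); count-neutral own lane OCTIC-WEIL22 (the item left open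
by gen 18's OCTIC-EB, which did `k`-signature `(1,3)` modulo Markman's SIXFOLD theorem).  Theorems only, no definition,
no named fact introduced, no `sorry`.  Assembles `Census/OcticWeilFourfold(Parts)` (combinatorics),
`CorCM/OcticWeilFourfoldFrameTransfer` (frame transfer under `2`-transitivity), gen 18's pair-part lemma
(`OcticCurveFourfold.weightClassesAlg_le_algebraicClasses_of_isPairPart`, same model map) and
`CorCM/OcticWeilFourfoldWeilParts` (Weil parts, from Markman's theorem).

SETTING (frame form; the intrinsic and geometric forms are the sequels `CorCM/OcticWeilFourfoldHodgeOfMarkman.lean`,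
`CorCM/OcticWeilFourfoldTwoTransitiveOfSimple.lean`).  `k = Kf i₀` imaginary quadratic (`[k:ℚ] = 2`), `F = Kf i₁ ⊇ i(k)`
of degree `8`, read in an enumeration `e : Hom(F, ℂ) ≃ Fin 4 × Bool` with `(e s).2 = [s ∘ i = τ]` (`he_sign`),
`e s̄ = ((e s).1, ¬(e s).2)` (`he_conj`); `A₂ 0 = B ⊨ (F; Φ)` with `Φ = e⁻¹ phi₂` (`hΦ`; `phi₂ = {(0,true), (1,true),
(2,false), (3,false)}` — `k`-signature `(2,2)`), `A₂ 1 = E ⊨ (k; {τ})` (`hΨ`); and `2`-TRANSITIVITY (`h2t`): every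
ordered pair of distinct conjugate pairs `(a, b)` is moved to `(0, 1)` by an automorphism of `ℂ` (for SIMPLE `B` this is
Dodson's theorem — sequel).  A power is `X = ⨁_j A₂(κ j)`, `κ : Fin N → Fin 2` ARBITRARY (all `B^n × E^a`, any order).

* `typeCount_eq_two_of_frame` — the frame gives the count `#{s ∈ Φ | s ∘ i = τ'} = 2` for both `τ'`;
* **`hodgeConjectureFor_biproduct_comp_of_frame₂_of_markman`** — `HodgeConjectureFor (⨁_j A₂ (κ j))` for EVERY `κ`,
  GIVEN ONLY `Markman2025_weilClasses_algebraic_abelianFourfold`: Pohlmann's theorem for the CM algebra `∏_j K_{κ j}`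
  (`Pohlmann1968_thm1_cmAlgebra`), frame transfer (`modelBalanced₂_of_isGaloisBalancedAlg`), the induction principle over
  pair parts and Weil parts (`Census/OcticWeilFourfoldParts.modelBalanced₂_induction`), the two part lemmas, and the
  multiplicativity of algebraic weight lines (`PairWeights.weightClassesAlg_union_le_algebraicClasses`);
  `…_of_avDominatedBy_…` — and for every abelian variety dominated by such a power (isogeny factors, quotients,
  abelian subvarieties).
HONEST FRAMING: CONDITIONAL on Markman's theorem for abelian FOURFOLDS of Weil type (arXiv:2502.03415 / 2509.23403
Thm. 1.2, unrefereed, a named fact NOT proved in the tree); `HC_CM` is not asserted; no case of the Hodge conjecture is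
claimed unconditionally here.  `B^n` ALONE is lit-pohlmann's `Pohlmann1968.SimpleCMFourfoldPowersHodgeConjecture`
(every simple CM fourfold); the content here is the CURVE FACTOR (it enters through divisors only, by the defect law).
[cite: Pohlmann1968, Thm 1] [cite: GaoUllmo2025, Thm 3.1] [cite: Milne2020HodgeClassesAV, 1.2 (a) and Thm. 1]
[cite: Markman2025SurveySecant, Thm. 1.2] [cite: MoonenZarhin1995Duke, Thm. 2.4] [cite: MumfordAV1970, §19]

## References
* [Pohlmann1968] H. Pohlmann, Ann. of Math. 88 (1968), Thm 1.  [GaoUllmo2025] Z. Gao, E. Ullmo, J. Inst. Math. Jussieu 25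
  (2025), Thm 3.1.  [Milne2020HodgeClassesAV] J. S. Milne, arXiv:2010.08857, 1.2 (a), Thm. 1.  [Markman2025SurveySecant]
  E. Markman, arXiv:2509.23403, Thm. 1.2 and §1.1.  [MoonenZarhin1995Duke] B. Moonen, Yu. Zarhin, Duke Math. J. 77
  (1995), Thm. 2.4.  [Gordon1999HodgeAVSurvey] B. B. Gordon, CRM Monogr. 10 (1999), 5.13 (ii).  [MumfordAV1970]
  D. Mumford, *Abelian Varieties*, §19.  [Dodson1984] B. Dodson, Trans. AMS 283 (1984), §3.3.2 Theorem.
-/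

noncomputable section

open CategoryTheory CategoryTheory.Limits NumberField

namespace Summit.HodgeConjecture.CorCM.OcticWeilFourfold

open Literature.AlgebraicGeometry Literature.AlgebraicGeometry.Motives Literature.AlgebraicGeometry.HodgeTheory
open Literature.AlgebraicGeometry.ComplexMultiplication (IsCMTypeRealisation)
open Literature.AlgebraicGeometry.Pohlmann1968
open Literature.AlgebraicTopology.SingularHomology
open Literature.NumberTheory.ComplexMultiplication
open Summit.HodgeConjecture.CorCM.Census.OcticCurveFourfold (Pt IsPairPart)
open Summit.HodgeConjecture.CorCM.Census.OcticWeilFourfold (phi₂ phi₂Pre inr_mem_phi₂Pre ModelBalanced₂ IsWeil₂Part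
  modelBalanced₂_induction)
open Summit.HodgeConjecture.CorCM.OcticCurveFourfold (toPt comp_eq_conjugate_of_snd_eq_false
  weightClassesAlg_le_algebraicClasses_of_isPairPart)
open Summit.HodgeConjecture.CorCM.DecicCurveFivefold (curveSlots₂ sigma_cases)
open Summit.HodgeConjecture.CorCM.PairWeights
open Summit.HodgeConjecture.CorCM.DihedralSexticPair (card_filter_equiv_mem)

open scoped Classical Pointwise

section Assembly

variable {I : Type} {Kf : I → Type} [∀ i, Field (Kf i)] [∀ i, NumberField (Kf i)] [∀ i, IsCMField (Kf i)]
  {i₀ i₁ : I} {N : ℕ} (κ : Fin N → Fin 2) {e : (Kf i₁ →+* ℂ) ≃ Fin 4 × Bool} {τ : Kf i₀ →+* ℂ} {i : Kf i₀ →+* Kf i₁}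
  {A₂ : Fin 2 → AbelianVariety ℂ} {Φ₂ : ∀ j : Fin 2, CMType (Kf (curveSlots₂ i₀ i₁ j))}
  {ι₂ : ∀ j, 𝓞 (Kf (curveSlots₂ i₀ i₁ j)) →+* End (A₂ j)}
  {θ₂ : ∀ j, Kf (curveSlots₂ i₀ i₁ j) →+* Module.End ℂ (complexBetti (A₂ j).X 1)}

/-! ### The count `(2, 2)` read off the frame -/

omit [∀ i, NumberField (Kf i)] [∀ i, IsCMField (Kf i)] in
/-- The finite facts: in the model, exactly two points of `phi₂` have sign `true` on the fourfold, and two have sign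
`false`. [folklore] -/
theorem card_phi₂_sign :
    ((Finset.univ : Finset (Fin 4 × Bool)).filter fun p => p.2 = true ∧ Sum.inr p ∈ phi₂).card = 2 ∧
    ((Finset.univ : Finset (Fin 4 × Bool)).filter fun p => p.2 = false ∧ Sum.inr p ∈ phi₂).card = 2 := by
  have h1 : ((Finset.univ : Finset (Fin 4 × Bool)).filter fun p => p.2 = true ∧ Sum.inr p ∈ phi₂) =
      (Finset.univ : Finset (Fin 4 × Bool)).filter fun p => p = (0, true) ∨ p = (1, true) := by
    refine Finset.filter_congr fun p _ => ?_
    rw [phi₂, inr_mem_phi₂Pre]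
    obtain ⟨a, c⟩ := p
    constructor
    · rintro ⟨h2, ⟨-, h | h⟩ | ⟨hb, -⟩⟩
      · left; simp only at h h2; rw [h, h2]
      · right; simp only at h h2; rw [h, h2]
      · simp only at h2 hb; rw [h2] at hb; exact absurd hb (by decide)
    · rintro (h | h) <;> simp only [Prod.mk.injEq] at h <;> obtain ⟨rfl, rfl⟩ := h
      · exact ⟨rfl, Or.inl ⟨rfl, Or.inl rfl⟩⟩
      · exact ⟨rfl, Or.inl ⟨rfl, Or.inr rfl⟩⟩
  have h2 : ((Finset.univ : Finset (Fin 4 × Bool)).filter fun p => p.2 = false ∧ Sum.inr p ∈ phi₂) =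
      (Finset.univ : Finset (Fin 4 × Bool)).filter fun p => p = (2, false) ∨ p = (3, false) := by
    refine Finset.filter_congr fun p _ => ?_
    rw [phi₂, inr_mem_phi₂Pre]
    obtain ⟨a, c⟩ := p
    constructor
    · rintro ⟨h2, ⟨hb, -⟩ | ⟨-, ha0, ha1⟩⟩
      · simp only at h2 hb; rw [h2] at hb; exact absurd hb (by decide)
      · simp only at h2 ha0 ha1
        subst h2
        rcases Census.OcticCurveFourfold.fin4_cases a with rfl | rfl | rfl | rfl
        · exact absurd rfl ha0
        · exact absurd rfl ha1
        · exact Or.inl rfl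
        · exact Or.inr rfl
    · rintro (h | h) <;> simp only [Prod.mk.injEq] at h <;> obtain ⟨rfl, rfl⟩ := h
      · exact ⟨rfl, Or.inr ⟨rfl, by decide, by decide⟩⟩
      · exact ⟨rfl, Or.inr ⟨rfl, by decide, by decide⟩⟩
  rw [h1, h2]
  exact ⟨by decide, by decide⟩

/-- **The type count read off the frame**: for `Φ = e⁻¹ phi₂` and `(e s).2 = [s ∘ i = τ]`, every complex embedding
`τ'` of `k` has `#{s ∈ Φ : s ∘ i = τ'} = 2` — `k`-signature `(2,2)`, `B` is an abelian fourfold of Weil type for `k`.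
[cite: Deligne1982HodgeCycles, §4 Prop. 4.4] [cite: MoonenZarhin1995Duke, Thm. 2.4] -/
theorem typeCount_eq_two_of_frame (h2 : Module.finrank ℚ (Kf i₀) = 2)
    (he_sign : ∀ s : Kf i₁ →+* ℂ, (e s).2 = true ↔ s.comp i = τ)
    {Φ : CMType (Kf i₁)} (hΦ : ∀ s : Kf i₁ →+* ℂ, s ∈ Φ.1 ↔ Sum.inr (e s) ∈ phi₂) (τ' : Kf i₀ →+* ℂ) :
    (Finset.univ.filter fun s : Kf i₁ →+* ℂ => s.comp i = τ' ∧ s ∈ Φ.1).card = 2 := by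
  have hττ : ComplexEmbedding.conjugate τ ≠ τ := QuarticCM.conjugate_ne τ
  have hk : ∀ σ : Kf i₀ →+* ℂ, σ = τ ∨ σ = ComplexEmbedding.conjugate τ := fun σ =>
    QuarticCM.eq_or_eq_conjugate_of_quadratic h2 τ σ
  rcases hk τ' with rfl | rfl
  · have hfilter : (Finset.univ.filter fun s : Kf i₁ →+* ℂ => s.comp i = τ' ∧ s ∈ Φ.1) =
        Finset.univ.filter fun s => e s ∈
          ((Finset.univ : Finset (Fin 4 × Bool)).filter fun p => p.2 = true ∧ Sum.inr p ∈ phi₂) := by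
      refine Finset.filter_congr fun s _ => ?_
      rw [← he_sign, hΦ s, Finset.mem_filter]
      exact ⟨fun h => ⟨Finset.mem_univ _, h⟩, fun h => h.2⟩
    rw [hfilter, card_filter_equiv_mem, card_phi₂_sign.1]
  · have hfilter : (Finset.univ.filter fun s : Kf i₁ →+* ℂ => s.comp i = ComplexEmbedding.conjugate τ ∧ s ∈ Φ.1) =
        Finset.univ.filter fun s => e s ∈
          ((Finset.univ : Finset (Fin 4 × Bool)).filter fun p => p.2 = false ∧ Sum.inr p ∈ phi₂) := by
      refine Finset.filter_congr fun s _ => ?_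
      rw [hΦ s, Finset.mem_filter]
      constructor
      · rintro ⟨h1, h3⟩
        refine ⟨Finset.mem_univ _, ?_, h3⟩
        cases hs : (e s).2
        · rfl
        · exact absurd (((he_sign s).1 hs).symm.trans h1) hττ.symm
      · rintro ⟨-, h1, h3⟩
        exact ⟨comp_eq_conjugate_of_snd_eq_false hk he_sign h1, h3⟩
    rw [hfilter, card_filter_equiv_mem, card_phi₂_sign.2]

/-! ### Assembly -/

/-- **MAIN THEOREM (frame form).  The Hodge conjecture for every product of copies `⨁_j A₂(κ j)` of `B` and `E` — i.e.
for `B^n × E^a`, all `n, a`, any order — GIVEN ONLY Markman's fourfold theorem**, for `B ⊨ (F; e⁻¹ phi₂)` a CM abelian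
fourfold of `k`-signature `(2,2)` over an octic CM field `F ⊇ i(k)` whose quartic part is `2`-TRANSITIVE under `Aut(ℂ/k)`
(`h2t`; Dodson: automatic when `B` is simple) and `E ⊨ (k; {τ})`: every rational `(p,p)`-class on `⨁_j A₂ (κ j)` is
algebraic, for every slot map `κ : Fin N → Fin 2`.  Pohlmann's theorem for the CM algebra `∏_j K_{κ j}`, frame transfer,
the induction principle over pair parts (divisor lines, gen 18's lemma) and Weil parts (lifted Weil lines of `B`,
algebraic by Markman's theorem and seat b30's distribution lemma), and multiplicativity of algebraic weight lines.
Leaves: `Markman2025_weilClasses_algebraic_abelianFourfold` ONLY. [cite: Markman2025SurveySecant, Thm. 1.2]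
[cite: Pohlmann1968, Thm 1] [cite: GaoUllmo2025, Thm 3.1] [cite: Milne2020HodgeClassesAV, 1.2 (a) and Thm. 1]
[cite: Dodson1984, §3.3.2 Theorem] -/
theorem hodgeConjectureFor_biproduct_comp_of_frame₂_of_markman
    (hW4 : Markman2025_weilClasses_algebraic_abelianFourfold) (κ : Fin N → Fin 2)
    (h8 : Module.finrank ℚ (Kf i₁) = 8) (h2 : Module.finrank ℚ (Kf i₀) = 2) (i : Kf i₀ →+* Kf i₁)
    (hA : ∀ j, IsCMTypeRealisation (Φ₂ j) (A₂ j) (ι₂ j) (θ₂ j))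
    (e : (Kf i₁ →+* ℂ) ≃ Fin 4 × Bool)
    (he_sign : ∀ s : Kf i₁ →+* ℂ, (e s).2 = true ↔ s.comp i = τ)
    (he_conj : ∀ s : Kf i₁ →+* ℂ, e (ComplexEmbedding.conjugate s) = ((e s).1, !(e s).2))
    (hΦ : ∀ s : Kf i₁ →+* ℂ, s ∈ (Φ₂ 0).1 ↔ Sum.inr (e s) ∈ phi₂)
    (hΨ : ∀ σ : Kf i₀ →+* ℂ, σ ∈ (Φ₂ (0 : Fin 1).succ).1 ↔ σ = τ)
    (h2t : ∀ a b : Fin 4, a ≠ b → ∃ ρ : ℂ ≃+* ℂ,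
      (ρ : ℂ →+* ℂ).comp (e.symm (a, true)) = e.symm (0, true) ∧ (ρ : ℂ →+* ℂ).comp (e.symm (b, true)) = e.symm (1, true)) :
    HodgeConjectureFor (⨁ fun j => A₂ (κ j)).dim (⨁ fun j => A₂ (κ j)).X := by
  have hττ : ComplexEmbedding.conjugate τ ≠ τ := QuarticCM.conjugate_ne τ
  have hk : ∀ σ : Kf i₀ →+* ℂ, σ = τ ∨ σ = ComplexEmbedding.conjugate τ := fun σ =>
    QuarticCM.eq_or_eq_conjugate_of_quadratic h2 τ σ
  have hcount := typeCount_eq_two_of_frame h2 he_sign hΦ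
  refine ⟨nonempty_hodgeModel_holds (Motives.AbelianVariety.isSmoothProjective_holds (A := ⨁ fun j => A₂ (κ j))),
    fun p c hc hH => ?_⟩
  have hAκ : ∀ j, IsCMTypeRealisation (Φ₂ (κ j)) (A₂ (κ j)) (ι₂ (κ j)) (θ₂ (κ j)) := fun j => hA (κ j)
  -- every balanced configuration has algebraic weight lines: induct over its generating parts
  have key : ∀ (R : Finset ((j : Fin N) × (Kf (curveSlots₂ i₀ i₁ (κ j)) →+* ℂ))),
      ModelBalanced₂ (fun x => toPt e τ ((Sigma.map κ (fun _ => id) :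
        ((j : Fin N) × (Kf (curveSlots₂ i₀ i₁ (κ j)) →+* ℂ)) → ((m : Fin 2) × (Kf (curveSlots₂ i₀ i₁ m) →+* ℂ))) x)) R →
      ∀ q, R.card = 2 * q → weightClassesAlg (fun j => A₂ (κ j)) (fun j => ι₂ (κ j)) (2 * q) R ≤
        algebraicClasses (⨁ fun j => A₂ (κ j)).X q := by
    intro R hR
    refine modelBalanced₂_induction (motive := fun R => ∀ q, R.card = 2 * q →
      weightClassesAlg (fun j => A₂ (κ j)) (fun j => ι₂ (κ j)) (2 * q) R ≤ algebraicClasses (⨁ fun j => A₂ (κ j)).X q)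
      (fun q hq => ?_) (fun G R hGR hG ih q hq => ?_) (fun G R b hGR hG ih q hq => ?_) hR
    · obtain rfl : q = 0 := by simpa using hq.symm
      exact fun c _ => hodgeConjectureFor_codim_zero c
    · -- a pair part: a divisor line (gen 18's lemma, same model map)
      obtain ⟨ha, hGalg⟩ := weightClassesAlg_le_algebraicClasses_of_isPairPart κ hττ hk he_conj hA hG
      have hRcard : R.card = 2 * (q - 1) := by
        have h := Finset.card_union_of_disjoint hGR
        rw [hq, ha] at h
        omega
      have haq : 1 + (q - 1) = q := by
        have h := Finset.card_union_of_disjoint hGR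
        rw [hq, ha] at h
        omega
      rw [← Finset.disjUnion_eq_union G R hGR]
      exact weightClassesAlg_union_le_algebraicClasses hAκ haq ha hRcard hGR hGalg (ih (q - 1) hRcard)
    · -- a Weil part: a lifted Weil line of `B`, algebraic by Markman's theorem
      obtain ⟨ha, hGalg⟩ :=
        weightClassesAlg_le_algebraicClasses_of_isWeil₂Part κ hW4 h8 h2 hττ hk he_sign hA hcount hG
      have hRcard : R.card = 2 * (q - 2) := by
        have h := Finset.card_union_of_disjoint hGR
        rw [hq, ha] at h
        omega
      have haq : 2 + (q - 2) = q := by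
        have h := Finset.card_union_of_disjoint hGR
        rw [hq, ha] at h
        omega
      rw [← Finset.disjUnion_eq_union G R hGR]
      exact weightClassesAlg_union_le_algebraicClasses hAκ haq ha hRcard hGR hGalg (ih (q - 2) hRcard)
  have hmem : c ∈ ⨆ S ∈ pohlmannSetsAlg (K := fun j => Kf (curveSlots₂ i₀ i₁ (κ j))) (fun j => Φ₂ (κ j)) p,
      weightClassesAlg (fun j => A₂ (κ j)) (fun j => ι₂ (κ j)) (2 * p) S := by
    rw [← (Pohlmann1968_thm1_cmAlgebra (fun j => Kf (curveSlots₂ i₀ i₁ (κ j))) (fun j => A₂ (κ j))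
      (fun j => Φ₂ (κ j)) (fun j => ι₂ (κ j)) (fun j => θ₂ (κ j)) hAκ p).1]
    exact Submodule.subset_span ⟨hc, hH⟩
  have hle : (⨆ S ∈ pohlmannSetsAlg (K := fun j => Kf (curveSlots₂ i₀ i₁ (κ j))) (fun j => Φ₂ (κ j)) p,
      weightClassesAlg (fun j => A₂ (κ j)) (fun j => ι₂ (κ j)) (2 * p) S) ≤
      algebraicClasses (⨁ fun j => A₂ (κ j)).X p := by
    refine iSup₂_le fun S hS => ?_
    exact key S (modelBalanced₂_of_isGaloisBalancedAlg hττ hk he_sign he_conj hΦ hΨ κ h2t hS.2) p hS.1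
  exact hle hmem

/-- **The Hodge conjecture for every abelian variety dominated by a product of copies `⨁_j A₂(κ j)`** (frame form,
modulo Markman's fourfold theorem): everything isogenous to a product of copies of `B`, `E` and their abelian
subvarieties and quotients. [cite: Markman2025SurveySecant, Thm. 1.2] [cite: MumfordAV1970, §19] -/
theorem hodgeConjectureFor_of_avDominatedBy_comp_of_frame₂_of_markman
    (hW4 : Markman2025_weilClasses_algebraic_abelianFourfold) (κ : Fin N → Fin 2)
    (h8 : Module.finrank ℚ (Kf i₁) = 8) (h2 : Module.finrank ℚ (Kf i₀) = 2) (i : Kf i₀ →+* Kf i₁)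
    (hA : ∀ j, IsCMTypeRealisation (Φ₂ j) (A₂ j) (ι₂ j) (θ₂ j))
    (e : (Kf i₁ →+* ℂ) ≃ Fin 4 × Bool)
    (he_sign : ∀ s : Kf i₁ →+* ℂ, (e s).2 = true ↔ s.comp i = τ)
    (he_conj : ∀ s : Kf i₁ →+* ℂ, e (ComplexEmbedding.conjugate s) = ((e s).1, !(e s).2))
    (hΦ : ∀ s : Kf i₁ →+* ℂ, s ∈ (Φ₂ 0).1 ↔ Sum.inr (e s) ∈ phi₂)
    (hΨ : ∀ σ : Kf i₀ →+* ℂ, σ ∈ (Φ₂ (0 : Fin 1).succ).1 ↔ σ = τ)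
    (h2t : ∀ a b : Fin 4, a ≠ b → ∃ ρ : ℂ ≃+* ℂ,
      (ρ : ℂ →+* ℂ).comp (e.symm (a, true)) = e.symm (0, true) ∧ (ρ : ℂ →+* ℂ).comp (e.symm (b, true)) = e.symm (1, true))
    {C : AbelianVariety ℂ} (hC : Domination.AVDominatedBy C (⨁ fun j => A₂ (κ j))) :
    HodgeConjectureFor C.dim C.X :=
  Domination.hodgeConjectureFor_of_avDominatedBy
    (hodgeConjectureFor_biproduct_comp_of_frame₂_of_markman hW4 κ h8 h2 i hA e he_sign he_conj hΦ hΨ h2t) hC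

end Assembly

end Summit.HodgeConjecture.CorCM.OcticWeilFourfold

end
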